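import Literature.NumberTheory.Transcendental.BakerQuantObstruction
import Literature.NumberTheory.Transcendental.DiazZeroLemmaMult
import Literature.NumberTheory.Transcendental.RoyCriterionProp3Proofs
import Literature.NumberTheory.Transcendental.TwoLogarithmsZeroLemma
import Summits.Schanuel.Schanuel.Theorems.SoloBlindPhilipponGaGmOne

/-!
# No exact zeros along `ℤ·(y, α)` above the Dirichlet line (finite form)

The zero-estimate face of condition (b) of Roy's Theorem 1 / Conjecture 2 (Roy 2001): for
`y ≠ 0`, `α ≠ 0` and integers `K, M, T₀, T₁` with
`c · max(1,T₀) · max(1,T₁) < (⌊K/2⌋+1)(⌊M/2⌋+1)` and (`α` not a root of unity or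
`c · max(1,T₁) < ⌊K/2⌋+1`), where `c = philC 1` is the constant of Philippon's zero estimate on
`G = 𝔾ₐ × 𝔾ₘ`, every non-zero `Q ∈ ℤ[X₀, X₁]` of bidegree `≤ (T₀, T₁)` — of ANY height — has
`(D^k Q)(my, α^m) ≠ 0` for some `k ≤ K`, `m ≤ M` (`D = ∂₀ + X₁∂₁ = royD`):
`roy_no_exact_zeros`. The asymptotic form in Roy's normalisation and its meaning for the
criterion are in `SoloInformedRoyNoExactWitness`.

Proof: exact zeros of the `D^k Q`, `k ≤ K`, at `γ_m = (my, α^m)` say that `P = Q ⊗ ℂ` vanishes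
to order `> K` along the one-parameter subgroup `t ↦ γ_m · (t, e^t)` (direction `w = (1,1)` of
`Lie G`, whose flow `t ↦ (x + t, u e^t)` is generated by `D`: `iteratedDeriv_aeval_add_mul_exp`).
The points `γ_m`, `m ≤ M`, contain `Σ(2)` for `Σ = {γ_m ; m ≤ M/2}`. Philippon's zero estimate
(PROVED in the tree: `Baker1975.Ch3.philippon`, from `Philippon1986_GaGm_holds`) yields a connected
algebraic subgroup `G' ≠ G` with `(⌊K/2⌋+1) · #((Σ+G')/G') · D₀^{dim V} · D₁^{dim T'} ≤ c D₀ D₁`.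
For `G' = 0` or `G' = 0 × 𝔾ₘ` the classes of the `γ_m` are distinct because `y ≠ 0`; for
`G' = 𝔾ₐ × 1` they are distinct as soon as `α` is not a root of unity; each case contradicts the
count. (If `α` has finite order `d`, `(X₁^d - 1)^{K+1}` IS an exact witness once
`d(K+1) ≤ T₁` — whence the alternative hypothesis.)

References: P. Philippon, *Lemmes de zéros dans les groupes algébriques commutatifs*, Bull. SMF
114 (1986), Thm. 2.1 [Philippon1986]; D. Roy, *An arithmetic criterion for the values of the
exponential function*, Acta Arith. 97 (2001), Thm. 1 (b), §4 [Roy2001]; N. A. V. Nguyen, D. Roy,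
IJNT 12 (2016), proof of Cor. 2 (the pattern "exact zeros ⇒ zero estimate") [NguyenRoy2016].
-/

noncomputable section

open MvPolynomial Filter Complex
open Literature.NumberTheory.Transcendental
open Literature.NumberTheory.Transcendental.GaGm (evalAt VanishesToOrder coord ConnAlgSubgroup
  sumset)
open Literature.NumberTheory.Transcendental.Baker1975.Ch3 (philC philippon one_le_philC
  mem_toSubgroup_of_top)

namespace Summit.Schanuel.Schanuel.Theorems

/-! ### The points `γ_j = (j y, α^j)` of `G = 𝔾ₐ × 𝔾ₘ` and the direction of `D` -/

/-- The point `γ_j = (j y, α^j) ∈ G(ℂ) = ℂ × ℂˣ` (`α ≠ 0` packaged as a unit `a`).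
[cite: Roy2001, Thm. 1 (b) (the points `(my, α^m)`)] -/
def roySubgrpPt (y : ℂ) (a : ℂˣ) (j : ℕ) : GaGm 1 :=
  (Multiplicative.ofAdd ((j : ℂ) * y), fun _ => a ^ j)

/-- `γ_0 = e`. [folklore] -/
theorem roySubgrpPt_zero (y : ℂ) (a : ℂˣ) : roySubgrpPt y a 0 = 1 :=
  Prod.ext (by simp [roySubgrpPt]) (funext fun _ => by simp [roySubgrpPt])

/-- `γ_{j+j'} = γ_j γ_{j'}`. [folklore] -/
theorem roySubgrpPt_add (y : ℂ) (a : ℂˣ) (j j' : ℕ) :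
    roySubgrpPt y a (j + j') = roySubgrpPt y a j * roySubgrpPt y a j' :=
  Prod.ext (by simp [roySubgrpPt, add_mul, ofAdd_add])
    (funext fun _ => by simp [roySubgrpPt, pow_add])

/-- For `y ≠ 0` the points `γ_j` are pairwise distinct (first coordinate). [folklore] -/
theorem roySubgrpPt_injective {y : ℂ} (hy : y ≠ 0) (a : ℂˣ) :
    Function.Injective (roySubgrpPt y a) := by
  intro j j' h
  have h1 : Multiplicative.toAdd (roySubgrpPt y a j).1 =
      Multiplicative.toAdd (roySubgrpPt y a j').1 := by rw [h]
  simp only [roySubgrpPt, toAdd_ofAdd] at h1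
  exact_mod_cast mul_right_cancel₀ hy h1

/-- The direction `w = (1, 1) ∈ Lie G = ℂ × ℂ` of Roy's derivation `D = ∂₀ + X₁∂₁`: the flow
`t ↦ γ · exp_G(t w)` through `γ = (x, u)` is `t ↦ (x + t, u e^t)`. [cite: Roy2001, §4 (p. 191)] -/
def royDDir : ℂ × (Fin 1 → ℂ) := (1, fun _ => 1)

/-- `w ≠ 0`. [folklore] -/
theorem royDDir_ne_zero : royDDir ≠ 0 := fun h => one_ne_zero (congrArg Prod.fst h)

/-- `P(γ_j · exp_G(t w)) = Q(jy + t, α^j e^t)` for `P = Q ⊗ ℂ`. [folklore] -/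
theorem evalAt_map_roySubgrpPt_mul_exp (Q : MvPolynomial (Fin 2) ℤ) (y : ℂ) (a : ℂˣ) (j : ℕ)
    (t : ℂ) :
    evalAt (MvPolynomial.map (Int.castRingHom ℂ) Q) (roySubgrpPt y a j * GaGm.exp (t • royDDir)) =
      aeval ![(j : ℂ) * y + t, (a : ℂ) ^ j * cexp t] Q := by
  have hc : coord (roySubgrpPt y a j * GaGm.exp (t • royDDir)) =
      ![(j : ℂ) * y + t, (a : ℂ) ^ j * cexp t] := by
    funext i
    refine Fin.cases ?_ (fun i => ?_) i
    · rw [GaGm.coord_zero]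
      simp [roySubgrpPt, GaGm.exp, royDDir, toAdd_mul]
    · rw [GaGm.coord_succ]
      have hi : i = 0 := Subsingleton.elim _ _
      subst hi
      simp [roySubgrpPt, GaGm.exp, royDDir, Units.val_pow_eq_pow_val]
  rw [GaGm.evalAt, hc, eval_map, aeval_def, algebraMap_int_eq]

/-- **Exact zeros of the `D^k Q` at `γ_j` = vanishing of `Q ⊗ ℂ` to high order along `exp_G(ℂ w)`
at `γ_j`.** [cite: Roy2001, §4 (p. 191)] -/
theorem vanishesToOrder_of_royD_zeros (Q : MvPolynomial (Fin 2) ℤ) (y : ℂ) (a : ℂˣ) {j K : ℕ}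
    (h : ∀ k ≤ K, aeval ![(j : ℂ) * y, (a : ℂ) ^ j] (royD^[k] Q) = 0) :
    VanishesToOrder (MvPolynomial.map (Int.castRingHom ℂ) Q) (ℂ ∙ royDDir) (roySubgrpPt y a j)
      (K + 1) := by
  refine DiazZLM.vanishesToOrder_of_iteratedDeriv (n := 1) royDDir_ne_zero fun k hk => ?_
  simp only [evalAt_map_roySubgrpPt_mul_exp]
  rw [iteratedDeriv_aeval_add_mul_exp]
  simpa only [add_zero, Complex.exp_zero, mul_one] using h k (Nat.lt_succ_iff.mp hk)

/-- Partial degrees do not increase under base change. [folklore] -/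
theorem degreeOf_map_intCast_le (Q : MvPolynomial (Fin 2) ℤ) (i : Fin 2) :
    (MvPolynomial.map (Int.castRingHom ℂ) Q).degreeOf i ≤ Q.degreeOf i := by
  rw [degreeOf_le_iff]
  exact fun m hm => monomial_le_degreeOf i (support_map_subset _ _ hm)

/-! ### Connected algebraic subgroups of `𝔾ₐ × 𝔾ₘ` -/

/-- The character `1 ∈ ℤ = X(𝔾ₘ)`. [folklore] -/
def gmChar₁ : Fin 1 → ℤ := fun _ => 1

/-- For `G' ≠ G`, the line `ℂ w` meets `Lie G'` only in `0` (`w = (1,1)` lies neither in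
`Lie(𝔾ₐ × 1) = ℂ × 0` nor in `Lie(0 × 𝔾ₘ) = 0 × ℂ`). [folklore] -/
theorem span_royDDir_inf_tangent_eq_bot (H : ConnAlgSubgroup 1)
    (hH : ¬ (H.addPart = true ∧ H.chars = ⊥)) : (ℂ ∙ royDDir) ⊓ H.tangent = ⊥ := by
  rw [eq_bot_iff]
  intro x hx
  obtain ⟨hxW, hxV⟩ := Submodule.mem_inf.mp hx
  obtain ⟨t, rfl⟩ := Submodule.mem_span_singleton.mp hxW
  rw [ConnAlgSubgroup.tangent, Submodule.mem_prod] at hxV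
  obtain ⟨h1, h2⟩ := hxV
  have ht : t = 0 := by
    cases hadd : H.addPart
    · rw [hadd] at h1
      simpa [royDDir] using h1
    · have hch : H.chars = ⊤ :=
        (TwoLog.chars_eq_bot_or_top H).resolve_left fun hb => hH ⟨hadd, hb⟩
      rw [torusTangent_eq_bot_of_chars_eq_top H hch, Submodule.mem_bot] at h2
      have := congrFun h2 0
      simpa [royDDir] using this
  rw [ht, zero_smul, Submodule.mem_bot]

/-- Modulo a subgroup with trivial unipotent part, the classes of the `γ_j` are distinct
(`y ≠ 0`). [folklore] -/
theorem roySubgrpPt_eq_of_mk_eq_of_addPart {y : ℂ} (hy : y ≠ 0) (a : ℂˣ) (H : ConnAlgSubgroup 1)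
    (hadd : H.addPart = false) {j j' : ℕ}
    (h : (QuotientGroup.mk (roySubgrpPt y a j) : GaGm 1 ⧸ H.toSubgroup) =
      QuotientGroup.mk (roySubgrpPt y a j')) : j = j' := by
  have hmem := QuotientGroup.eq.mp h
  have h1 : ((roySubgrpPt y a j)⁻¹ * roySubgrpPt y a j').1 = 1 := hmem.1 hadd
  have h2 : Multiplicative.toAdd ((roySubgrpPt y a j)⁻¹ * roySubgrpPt y a j').1 = 0 := by
    rw [h1]; rfl
  simp only [roySubgrpPt, Prod.fst_mul, Prod.fst_inv, toAdd_mul, toAdd_inv, toAdd_ofAdd] at h2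
  have h3 : ((j' : ℂ) - j) * y = 0 := by linear_combination h2
  rcases mul_eq_zero.mp h3 with h4 | h4
  · have : (j' : ℂ) = j := by linear_combination h4
    exact_mod_cast this.symm
  · exact absurd h4 hy

/-- Modulo `𝔾ₐ × 1`, the classes of the `γ_j` are distinct as soon as `α` is not a root of unity.
[folklore] -/
theorem roySubgrpPt_eq_of_mk_eq_of_chars {y : ℂ} {a : ℂˣ} (ha : ∀ d : ℕ, 1 ≤ d → (a : ℂ) ^ d ≠ 1)
    (H : ConnAlgSubgroup 1) (hch : H.chars = ⊤) {j j' : ℕ}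
    (h : (QuotientGroup.mk (roySubgrpPt y a j) : GaGm 1 ⧸ H.toSubgroup) =
      QuotientGroup.mk (roySubgrpPt y a j')) : j = j' := by
  have hmem := QuotientGroup.eq.mp h
  have h1 := hmem.2 gmChar₁ (by rw [hch]; exact AddSubgroup.mem_top _)
  rw [Fin.prod_univ_one] at h1
  simp only [gmChar₁, zpow_one, roySubgrpPt, Prod.snd_mul, Prod.snd_inv, Pi.mul_apply,
    Pi.inv_apply] at h1
  have h2 : a ^ j = a ^ j' := inv_mul_eq_one.mp h1
  by_contra hne
  rcases Nat.lt_or_gt_of_ne hne with hlt | hlt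
  · have h3 : a ^ (j' - j) = 1 := by rw [pow_sub a hlt.le, ← h2, mul_inv_cancel]
    apply ha (j' - j) (by omega)
    rw [← Units.val_pow_eq_pow_val, h3, Units.val_one]
  · have h3 : a ^ (j - j') = 1 := by rw [pow_sub a hlt.le, h2, mul_inv_cancel]
    apply ha (j - j') (by omega)
    rw [← Units.val_pow_eq_pow_val, h3, Units.val_one]

/-! ### The zero-estimate face of condition (b) -/

/-- **No exact zeros along `ℤ·(y, α)` above the Dirichlet line (finite form).** Let `y ≠ 0`,
`α ≠ 0`, `c = philC 1` (Philippon's constant for `𝔾ₐ × 𝔾ₘ`). If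
`c · max(1,T₀) · max(1,T₁) < (⌊K/2⌋+1)(⌊M/2⌋+1)` and either `α` is not a root of unity or
`c · max(1,T₁) < ⌊K/2⌋+1`, then every non-zero `Q ∈ ℤ[X₀, X₁]` of bidegree `≤ (T₀, T₁)` — of any
height — has `(D^k Q)(my, α^m) ≠ 0` for some `k ≤ K`, `m ≤ M`.
[cite: Philippon1986, Thm. 2.1; Roy2001, Thm. 1 (b)] -/
theorem roy_no_exact_zeros {y α : ℂ} (hy : y ≠ 0) (hα : α ≠ 0) {K M T₀ T₁ : ℕ}
    (hcount : philC 1 * max 1 T₀ * max 1 T₁ < (K / 2 + 1) * (M / 2 + 1))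
    (htor : (∀ d : ℕ, 1 ≤ d → α ^ d ≠ 1) ∨ philC 1 * max 1 T₁ < K / 2 + 1)
    (Q : MvPolynomial (Fin 2) ℤ) (hQ : Q ≠ 0) (h0 : Q.degreeOf 0 ≤ T₀) (h1 : Q.degreeOf 1 ≤ T₁) :
    ∃ k m : ℕ, k ≤ K ∧ m ≤ M ∧ aeval ![(m : ℂ) * y, α ^ m] (royD^[k] Q) ≠ 0 := by
  classical
  by_contra hcon
  push Not at hcon
  set a : ℂˣ := Units.mk0 α hα with ha_def
  have haval : (a : ℂ) = α := rfl
  set c := philC 1 with hc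
  set D₀ := max 1 T₀ with hD₀
  set D₁ := max 1 T₁ with hD₁
  set T := K / 2 with hT
  set M' := M / 2 with hM'
  have hD₀1 : 1 ≤ D₀ := le_max_left _ _
  have hD₁1 : 1 ≤ D₁ := le_max_left _ _
  -- the polynomial over `ℂ`
  have hP0 : MvPolynomial.map (Int.castRingHom ℂ) Q ≠ 0 := fun h =>
    hQ (map_injective _ (RingHom.injective_int _) (h.trans (map_zero _).symm))
  have hdeg0 : (MvPolynomial.map (Int.castRingHom ℂ) Q).degreeOf 0 ≤ D₀ :=
    (degreeOf_map_intCast_le Q 0).trans (h0.trans (le_max_right _ _))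
  have hdeg1 : ∀ s ∈ (MvPolynomial.map (Int.castRingHom ℂ) Q).support,
      ∑ j : Fin 1, s (Fin.succ j) ≤ D₁ := by
    intro s hs
    rw [Fin.sum_univ_one]
    exact (monomial_le_degreeOf (1 : Fin 2) (support_map_subset _ _ hs)).trans
      (h1.trans (le_max_right _ _))
  -- the set `Σ = {γ_j ; j ≤ M/2}`
  set S : Set (GaGm 1) := roySubgrpPt y a '' ↑(Finset.range (M' + 1)) with hS
  have h1S : (1 : GaGm 1) ∈ S := ⟨0, by simp, roySubgrpPt_zero y a⟩
  have hfin : S.Finite := (Finset.finite_toSet _).image _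
  have hW : 0 < Module.finrank ℂ (ℂ ∙ royDDir) := by
    rw [finrank_span_singleton royDDir_ne_zero]; exact one_pos
  -- vanishing on `Σ(2) ⊆ {γ_j ; j ≤ M}` to order `K + 1 ≥ 2⌊K/2⌋ + 1`
  have hvan : ∀ g ∈ sumset S (1 + 1),
      VanishesToOrder (MvPolynomial.map (Int.castRingHom ℂ) Q) (ℂ ∙ royDDir) g
        ((1 + 1) * T + 1) := by
    rintro g ⟨σ, hσ, rfl⟩
    choose sf hsf hsfeq using hσ
    have hprod : ∏ i, σ i = roySubgrpPt y a (∑ i, sf i) := by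
      rw [Fin.prod_univ_two, Fin.sum_univ_two, roySubgrpPt_add, hsfeq 0, hsfeq 1]
    rw [hprod]
    have h0' : sf 0 < M' + 1 := by simpa using hsf 0
    have h1' : sf 1 < M' + 1 := by simpa using hsf 1
    have hle : ∑ i, sf i ≤ M := by rw [Fin.sum_univ_two]; omega
    refine (vanishesToOrder_of_royD_zeros Q y a (K := K) fun k hk => ?_).mono (by omega)
    rw [haval]
    exact hcon k _ hk hle
  obtain ⟨H, ⟨g₀, hg₀⟩, hineq⟩ := philippon 1 D₀ D₁ T (ℂ ∙ royDDir) S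
    (MvPolynomial.map (Int.castRingHom ℂ) Q) hD₀1 hD₁1 hW hfin h1S hP0 hdeg0 hdeg1 hvan
  -- `G' ≠ G`
  have hnot_top : ¬ (H.addPart = true ∧ H.chars = ⊥) := by
    rintro ⟨hadd, hch⟩
    apply hP0
    apply DiazZL.eq_zero_of_forall_evalAt
    intro u
    have := hg₀ (g₀⁻¹ * u) (mem_toSubgroup_of_top H hadd hch _)
    rwa [mul_inv_cancel_left] at this
  -- the counting inequality: `(T+1) · N · D₀^{δ₀} · D₁^{δ₁} ≤ c D₀ D₁`
  have hfrW : Module.finrank ℂ (ℂ ∙ royDDir) = 1 := finrank_span_singleton royDDir_ne_zero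
  have hfr0 : Module.finrank ℂ ↥((ℂ ∙ royDDir) ⊓ H.tangent) = 0 := by
    rw [span_royDDir_inf_tangent_eq_bot H hnot_top, finrank_bot]
  rw [hfrW, hfr0, Nat.sub_zero, Nat.choose_one_right, pow_one] at hineq
  set N := Set.ncard ((QuotientGroup.mk : GaGm 1 → GaGm 1 ⧸ H.toSubgroup) '' S) with hN
  have hN1 : 1 ≤ N := (Set.ncard_pos (hfin.image _)).mpr ⟨_, ⟨1, h1S, rfl⟩⟩
  have hcardS : S.ncard = M' + 1 := by
    rw [hS, (roySubgrpPt_injective hy a).injOn.ncard_image, Set.ncard_coe_finset,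
      Finset.card_range]
  have hN_of_inj : Set.InjOn (QuotientGroup.mk : GaGm 1 → GaGm 1 ⧸ H.toSubgroup) S →
      N = M' + 1 := fun hinj => by rw [hN, hinj.ncard_image, hcardS]
  cases hadd : H.addPart
  · -- `V = 0`: the additive coordinate separates the classes, `N = M' + 1`
    have hinj : Set.InjOn (QuotientGroup.mk : GaGm 1 → GaGm 1 ⧸ H.toSubgroup) S := by
      intro x hx x' hx' hxx'
      obtain ⟨j, _, rfl⟩ := hx
      obtain ⟨j', _, rfl⟩ := hx'
      rw [roySubgrpPt_eq_of_mk_eq_of_addPart hy a H hadd hxx']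
    have ha0 : H.addDim = 0 := by simp [ConnAlgSubgroup.addDim, hadd]
    rw [hN_of_inj hinj, ha0, pow_zero, mul_one] at hineq
    have hle : (T + 1) * (M' + 1) ≤ (T + 1) * (M' + 1) * D₁ ^ H.torusDim :=
      Nat.le_mul_of_pos_right _ (pow_pos (by omega) _)
    exact absurd ((hle.trans hineq).trans_lt hcount) (lt_irrefl _)
  · -- `V = 𝔾ₐ`, hence `T' = 1` (`G' ≠ G`): `δ₀ = 1`, `δ₁ = 0`
    have hch : H.chars = ⊤ :=
      (TwoLog.chars_eq_bot_or_top H).resolve_left fun hb => hnot_top ⟨hadd, hb⟩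
    have ha1 : H.addDim = 1 := by simp [ConnAlgSubgroup.addDim, hadd]
    have ht0 : H.torusDim = 0 := by
      rw [ConnAlgSubgroup.torusDim, torusTangent_eq_bot_of_chars_eq_top H hch, finrank_bot]
    rw [ha1, ht0, pow_one, pow_zero, mul_one] at hineq
    have hineq' : (T + 1) * N ≤ c * D₁ := by
      have h' : (T + 1) * N * D₀ ≤ c * D₁ * D₀ := by
        calc (T + 1) * N * D₀ ≤ c * D₀ * D₁ := hineq
          _ = c * D₁ * D₀ := by ring
      exact Nat.le_of_mul_le_mul_right h' (by omega)
    rcases htor with hnt | hsmall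
    · have hnt' : ∀ d : ℕ, 1 ≤ d → (a : ℂ) ^ d ≠ 1 := by rw [haval]; exact hnt
      have hinj : Set.InjOn (QuotientGroup.mk : GaGm 1 → GaGm 1 ⧸ H.toSubgroup) S := by
        intro x hx x' hx' hxx'
        obtain ⟨j, _, rfl⟩ := hx
        obtain ⟨j', _, rfl⟩ := hx'
        rw [roySubgrpPt_eq_of_mk_eq_of_chars hnt' H hch hxx']
      rw [hN_of_inj hinj] at hineq'
      have hle : c * D₁ ≤ c * D₀ * D₁ := by
        calc c * D₁ = c * 1 * D₁ := by ring
          _ ≤ c * D₀ * D₁ := by gcongr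
      exact absurd ((hineq'.trans hle).trans_lt hcount) (lt_irrefl _)
    · have hle : T + 1 ≤ (T + 1) * N := Nat.le_mul_of_pos_right _ hN1
      exact absurd ((hle.trans hineq').trans_lt hsmall) (lt_irrefl _)

end Summit.Schanuel.Schanuel.Theorems

end
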